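import Literature.MathematicalPhysics.QuantumFieldTheory.Balaban1983to89.Beta.RemainderOriginTowerPlaquetteAnyDisplay

/-!
# T. Bałaban, *Propagators for lattice gauge theories in a background field*, Commun. Math. Phys. **99** (1985) 389–434 [Balaban1985BackgroundPropagators]
# (3.137) p. 423 *«hence |(Δ⁽²⁾A)(b)| ≦ O(1)Mα₀(Lʲη)⁻²|A|, b ∈ Δ(y), y ∈ Λ_j, (3.137) and the supremum |A| is taken over several j-blocks surrounding Δ(y)»*,
# read against T. Bałaban, *The variational problem and background fields in renormalization group method for lattice gauge theories*, Commun. Math. Phys.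
# **102** (1985) 277–309 [Balaban1985Variational] (182) p. 307, (190) p. 308: **NODE D OF ROW (D4) AT THE ORIGIN ON PRINT's SMALL-FIELD CLASS WITH `Δ⁽²⁾` IN
# PRINT's (3.137) LOCAL-SUP DISPLAY** — the END «Y12f» `Beta.RemainderOriginTowerPlaquetteAnyDisplay.exists_ineq190_origin_tower_plaquette_anyDisplay` whose last
# displayed analytic letter `hD2` (an abstract block majorant `K_D` of finite range with row ∕ column sums `≤ λ`) is RE-TYPED as print's sentence (3.137)
# (a pointwise bound at each fine bond by `λ₀ ×` the supremum over the surrounding blocks); majorant, range and sums DERIVED («Y13a», this lineage gen 114)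

CITATION HEADER (lean-in-tree rule 2026-08-18).  Audit cell `pub-balaban`, BINDER row (D4) (`RemainderConst` leaves for Bałaban's split), OWNER lineage
`b2b-balaban-beta-an4`, gen 114.  [Balaban1985BackgroundPropagators] (B9 = [5]; held `paper:balaban1985-cmp99-background-propagators`, journal page = PDF page
+ 388) (3.134)–(3.138) pp. 422–423 — (3.137) quoted above from p. 423, re-read this generation on the held text; [Balaban1985Variational] (B11 = [15]; held
`paper:balaban1985-cmp102-variational-background`, journal page = PDF page + 276) (180) p. 306 *«From the estimate (3.137) it follows that Δ⁽²⁾ is a small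
perturbation of Δ_a»*, (182) p. 307, (190) p. 308; [Balaban1984PropagatorsII] (B6 = [3]) (2.51)–(2.52) p. 232, Lemma 2.1 (2.61) p. 234 (row sums);
every other locus exactly as in «Y12f» ∕ «Y12b» ∕ «Y12a» (this lineage, gen 112).  Composed BY NAME: «Y12f»
`exists_ineq190_origin_tower_plaquette_anyDisplay`; `B11SupSize190` (`supSize`, `norm_apply_le_loc`, `loc_le_of_forall`, `supSize_isLoc_iff`);
`B9Thm37GlueTorus.torusSum_tdist1_le` ((2.61) at one scale).  Nothing of print is asserted here.

WHY THIS FILE («Y13a»).  After gen 112 the three ENDs of NODE D at the origin («Y12f» value, «Y12g» divergence, «Y12h» slice gradient) display, besides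
print's three windows, the weights and the Hilbert-structure letters, exactly ONE analytic letter: `Δ⁽²⁾`'s majorant `hD2 : HasMaj S^{fine} S^{fine}
(Δ⁽²⁾)ᵉ↾ℝ K_D` with a kernel `K_D ≥ 0` of range `r_D` (`hDloc`) and row ∕ column sums `≤ λ` (`hDrow`, `hDcol`) — the CURRENCY of [3] (2.51).  Print states
(3.137) as a POINTWISE LOCAL-SUP bound.  THIS FILE proves that print's display suffices and re-exports the value END in it:
* §1 **`hasMaj_supSize_of_localSup`** (generic: any `B6.Geometry`, any point set `X`, the sup sizes of (190) over the fibres of a block map): a local-sup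
  bound `‖(Tf)(x)‖ ≤ λ₀·F` whenever `‖f‖ ≤ F` on the blocks within distance `r` of the block of `x` ⟹ `HasMaj S S T (λ₀·𝟙[d ≤ r])`; the indicator kernel is
  `≥ 0` (`localSupKernel_nonneg`) and has range `r` (`localSupKernel_loc`);
* §2 **`sum_localSupKernel_le`** ∕ **`sum_localSupKernel_le'`**: on the one-scale torus of blocks `UT m` (`ℓ¹` distance), row and column sums of the
  indicator kernel are `≤ λ₀·e^{σr}·c₀(1,σ)^d` for every rate `σ > 0` ((2.61), `torusSum_tdist1_le`) — uniformly in the torus;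
* §3 **`localSup_package`** — on NE9's carriers (fine bonds of the tower, blocks = the unit torus `UT m` through `blockCoord ∘ bpos`, geometry
  `toB6 (torusGeom m …)`): the (3.137) display ⟹ the six data `(0 ≤ λ, K_D ≥ 0, range r_D, row sums, column sums, HasMaj)` the ENDs consume, with
  `K_D = λ₀·𝟙[d₁ ≤ r_D]`, `λ = λ₀·e^{σ r_D}·c` — the lemma «Y13b»∕«Y13c» (divergence ∕ slice-gradient lines) reuse;
* §4 **`exists_ineq190_origin_tower_plaquette_localSup`** — «Y12f»'s value END with `(K_D, λ, hKD, hDloc, hDrow, hDcol, hD2)` REPLACED by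
  `(λ₀ ≥ 0, r_D, hD2 : the (3.137) display on the fine carrier)` and `λ := λ₀·e^{σ r_D}·c` (`c = c₀(1,σ)^d` the END's free row-sum constant) substituted
  into the derived constants `q`, `θ_P`, `θ_D`; conclusion VERBATIM («Y12f»: `G′ = (Δ_{a,k}(U) − Δ⁽²⁾)⁻¹` and `(Q_kG′Q_k†)⁻¹` two-sided, and
  `∀ δ′, δ′∕8 ≤ ρ → Ineq190 S^{coarse}_m S^{fine}_m (H₀ + G̃Δ⁽²⁾H₀) (A₀ + B_G̃θ_Dc) δ′` at the consumer's display ∕ witness).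
So NODE D's last displayed analytic letter reads as print's (3.137): a supplier of Bałaban's `Δ⁽²⁾(U)` at the tower ((3.134) `⟨A, Δ⁽²⁾A⟩ = 2⟨H̃C⁽²⁾(A), J⟩`;
`H̃`'s (3.133) tower row is NE9's `B9Eq3126H1kPiSupRowClosed`; `C⁽²⁾` = [4] (136)) has to deliver EXACTLY this pointwise sentence, with `λ₀ = O(1)·M·α`.

HONEST SCOPE.  [folklore] bookkeeping (an indicator kernel, the triangle inequality, (2.61) at one scale) + ONE application of «Y12f»; NO estimate of [5],
[15] or [4] is proved here; (3.137) itself is NOT proved for any operator — it is the HYPOTHESIS `hD2`, now in print's shape; Bałaban's `Δ⁽²⁾(U)` is NOT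
constructed (NODE-O-class identification NOT done; `Δ⁽²⁾ = 0` at `U = 1`).  What stays displayed is exactly as in «Y12f» otherwise (print's three windows
read GLOBALLY on the torus, the weights `ρ_w`, the Hilbert-structure letters, the two smallnesses — now in `λ₀`).  Row (D4) class UNCHANGED (instance 0∕1;
critical-path width 0 = NODE O; D4 DISCHARGE NO DATE); NOT B12 Thm 2, NOT BetaPertH, NOT continuum, NOT Clay.  HONEST DEPENDENCY (cell line): continuum YM
on T⁴ ⇐ BetaPertH ∧ nine spine estimates (0/9 proved); BetaPertH ⇐ (D1) ∧ (D4) ∧ CAP+tail; G-an2-4 gates asym, D1 and NE2/3/4.  NEW file; nothing modified;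
0 `def`; standard axioms; no `sorry`; `maxHeartbeats 400000` on the one END (as «Y12f»).  Net new unproved facts: 0. -/

noncomputable section

open scoped BigOperators InnerProductSpace ComplexConjugate

namespace Literature.MathematicalPhysics.QuantumFieldTheory.Balaban1983to89.Beta.RemainderOriginTowerPlaquetteLocalSup

open B11SectG B11SupSize190
open B4Sect5Torus (TSite tdist tdist_nonneg)
open B4Sect5Proof (latticeConst)
open B5TorusCover (UT)
open B9Thm34Ext (toB6)
open B9Thm37GlueTorus (torusGeom tdist1 tdist1_comm torusSum_tdist1_le)
open B9SectCLatticeCarrier (Bond bpos unshift)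
open B9Eq311L2Pairing (WL2)
open B9Eq319QprimeTorus (blockCoord)
open B9Eq315QTower (towerP UlevOf)
open B9Eq315QTorus (perCfg perCfg_apply cornerSite)
open B9Eq316TowerFlatIsOneStep (siteCast towerP_eq_fineP_pow)
open B7Prop1Explicit (U1 Wcx boxVec)
open B7Prop2Explicit (c2' unitaryUnits)
open B9Eq310DeltaPrime (plaqHolU)
open B11Eq103H1Complex (SiteL2K BondL2K)
open B9Eq326OperatorTower (laplaceAk QkW G1k H1k)
open Beta.RemainderOriginTowerPlaquetteAnyDisplay (exists_ineq190_origin_tower_plaquette_anyDisplay)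

/-! ## §1  Print's (3.137) local-sup display IS a finite-range block majorant for the sup sizes of (190) -/

section LocalSup

variable {g : B6.Geometry} {X : Type} {E : Type} [NormedAddCommGroup E] [Module ℝ E]
  {box : g.Site → Finset X} {blk : X → g.Site}

/-- **THE INDICATOR KERNEL of a local-sup display**: `K(y, y′) = λ₀` if `d(y, y′) ≤ r`, else `0` — the block majorant of an operator whose value at a
point of the block `Δ(y)` is bounded by `λ₀ ×` the supremum of its argument over the blocks within distance `r` of `y` (*«the supremum |A| is taken over
several j-blocks surrounding Δ(y)»*). [cite: Balaban1985BackgroundPropagators, (3.137) p.423] [cite: Balaban1984PropagatorsII, (2.51)–(2.52) p.232] -/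
theorem localSupKernel_nonneg {lam₀ r : ℝ} (hlam : 0 ≤ lam₀) (y v : g.Site) :
    0 ≤ (if g.dist y v ≤ r then lam₀ else 0) := by
  split_ifs <;> [exact hlam; exact le_rfl]

/-- The indicator kernel has range `r`: `K(y, v) ≠ 0 → d(y, v) ≤ r`. [cite: Balaban1985BackgroundPropagators, (3.137) p.423] -/
theorem localSupKernel_loc {lam₀ r : ℝ} (y v : g.Site) (h : (if g.dist y v ≤ r then lam₀ else 0) ≠ 0) : g.dist y v ≤ r := by
  by_contra hc
  exact h (if_neg hc)

/-- **PRINT's (3.137) DISPLAY IS A BLOCK MAJORANT.**  For the sup sizes of (190) over the fibres of a block map (`x ∈ box y ↔ blk x = y`) and an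
`ℝ`-linear `T` on `X → E`: if for every point `x`, every `f` and every `F ≥ 0` bounding `‖f(x′)‖` on the blocks within distance `r` of the block of `x`
one has `‖(Tf)(x)‖ ≤ λ₀·F` (*«|(Δ⁽²⁾A)(b)| ≤ O(1)Mα₀(Lʲη)⁻²|A|, b ∈ Δ(y), … the supremum |A| is taken over several j-blocks surrounding Δ(y)»*), then
`HasMaj S S T K` with the indicator kernel `K(y, y′) = λ₀·𝟙[d(y, y′) ≤ r]` ([3] (2.51): *«(size of Tμ near y) ≤ K(y,y′)·(size of μ), μ localised near
y′»*).  Proof: `hasMaj_supSize_of_local`'s mechanism — for `μ` vanishing off `Δ(y′)`, take `F :=` the size of `μ` at `y′` if `d(y, y′) ≤ r`, else `F := 0`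
(then every block within distance `r` of `y` misses `Δ(y′)`). [cite: Balaban1985BackgroundPropagators, (3.137) p.423] [cite: Balaban1984PropagatorsII, (2.51)–(2.52) p.232]
[cite: Balaban1985Variational, (190) p.308] -/
theorem hasMaj_supSize_of_localSup (hbox : ∀ y x, x ∈ box y ↔ blk x = y) (T : (X → E) →ₗ[ℝ] (X → E))
    {lam₀ r : ℝ} (hlam : 0 ≤ lam₀)
    (hloc : ∀ (f : X → E) (x : X) (F : ℝ), 0 ≤ F → (∀ x', g.dist (blk x) (blk x') ≤ r → ‖f x'‖ ≤ F) → ‖T f x‖ ≤ lam₀ * F) :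
    HasMaj (supSize g box blk) (supSize g box blk) T (fun y v => if g.dist y v ≤ r then lam₀ else 0) := by
  intro v μ hμ y
  have hμv : ∀ x, blk x ≠ v → μ x = 0 := (supSize_isLoc_iff v μ).1 hμ
  have hS0 : 0 ≤ (supSize g box blk : BlockNorm g (X → E)).loc v μ := (supSize g box blk : BlockNorm g (X → E)).loc_nonneg v μ
  refine loc_le_of_forall (mul_nonneg (localSupKernel_nonneg hlam y v) hS0) fun x hx => ?_
  have hbx : blk x = y := (hbox y x).1 hx
  show ‖T μ x‖ ≤ (if g.dist y v ≤ r then lam₀ else 0) * _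
  by_cases hyv : g.dist y v ≤ r
  · rw [if_pos hyv]
    refine hloc μ x _ hS0 fun x' _ => ?_
    by_cases hx' : blk x' = v
    · exact norm_apply_le_loc ((hbox v x').2 hx') μ
    · rw [hμv x' hx', norm_zero]; exact hS0
  · rw [if_neg hyv, zero_mul]
    have h := hloc μ x 0 le_rfl fun x' hx'd => by
      by_cases hx' : blk x' = v
      · exact absurd (hbx ▸ hx' ▸ hx'd) hyv
      · rw [hμv x' hx', norm_zero]
    simpa using h

end LocalSup

/-! ## §2  Row and column sums of the indicator kernel on the torus of blocks ([3] Lemma 2.1 (2.61) at one scale) -/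

section Torus

variable {d : ℕ} {m : Fin d → ℕ} [∀ i, NeZero (m i)]

/-- One term: `λ₀·𝟙[t ≤ r] ≤ λ₀·e^{σr}·e^{−σt}` for `λ₀ ≥ 0`, `σ ≥ 0`. [folklore] -/
private theorem indicator_le_exp {lam₀ r σ t : ℝ} (hlam : 0 ≤ lam₀) (hσ : 0 ≤ σ) :
    (if t ≤ r then lam₀ else 0) ≤ lam₀ * Real.exp (σ * r) * Real.exp (-(σ * 1 * t)) := by
  split_ifs with h
  · have h1 : (1 : ℝ) ≤ Real.exp (σ * r) * Real.exp (-(σ * 1 * t)) := by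
      rw [← Real.exp_add]
      exact Real.one_le_exp (by nlinarith)
    calc lam₀ = lam₀ * 1 := (mul_one _).symm
      _ ≤ lam₀ * (Real.exp (σ * r) * Real.exp (-(σ * 1 * t))) := mul_le_mul_of_nonneg_left h1 hlam
      _ = lam₀ * Real.exp (σ * r) * Real.exp (-(σ * 1 * t)) := by ring
  · positivity

/-- **ROW SUM of the indicator kernel** on the one-scale torus of blocks `UT m` with the `ℓ¹` torus distance: for every rate `σ > 0`,
`Σ_v λ₀𝟙[d₁(y,v) ≤ r] ≤ λ₀·e^{σr}·c₀(1,σ)^d` — the number of blocks within distance `r` is bounded through (2.61) (`torusSum_tdist1_le`), uniformly in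
the torus. [cite: Balaban1984PropagatorsII, Lemma 2.1 (2.61) p.234] [cite: Balaban1985BackgroundPropagators, (3.137) p.423] -/
theorem sum_localSupKernel_le (y : UT m) {lam₀ r σ : ℝ} (hlam : 0 ≤ lam₀) (hσ : 0 < σ) :
    ∑ v : UT m, (if tdist1 m y v ≤ r then lam₀ else 0) ≤ lam₀ * Real.exp (σ * r) * B6.c0 1 σ ^ d := by
  calc ∑ v : UT m, (if tdist1 m y v ≤ r then lam₀ else 0)
      ≤ ∑ v : UT m, lam₀ * Real.exp (σ * r) * Real.exp (-(σ * 1 * tdist1 m y v)) :=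
        Finset.sum_le_sum fun v _ => indicator_le_exp hlam hσ.le
    _ = lam₀ * Real.exp (σ * r) * ∑ v : UT m, Real.exp (-(σ * 1 * tdist1 m y v)) := by rw [Finset.mul_sum]
    _ ≤ lam₀ * Real.exp (σ * r) * B6.c0 1 σ ^ d :=
        mul_le_mul_of_nonneg_left (torusSum_tdist1_le y (by simpa using hσ)) (by positivity)

/-- **COLUMN SUM of the indicator kernel** (the `ℓ¹` torus distance is symmetric): `Σ_y λ₀𝟙[d₁(y,v) ≤ r] ≤ λ₀·e^{σr}·c₀(1,σ)^d`.
[cite: Balaban1984PropagatorsII, Lemma 2.1 (2.61) p.234] [cite: Balaban1985BackgroundPropagators, (3.137) p.423] -/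
theorem sum_localSupKernel_le' (v : UT m) {lam₀ r σ : ℝ} (hlam : 0 ≤ lam₀) (hσ : 0 < σ) :
    ∑ y : UT m, (if tdist1 m y v ≤ r then lam₀ else 0) ≤ lam₀ * Real.exp (σ * r) * B6.c0 1 σ ^ d := by
  simp_rw [tdist1_comm _ v]
  exact sum_localSupKernel_le v hlam hσ

end Torus


/-! ## §3  The (3.137) display packaged as the END's six data on NE9's carriers -/

section Package

/-- `ofSite a = y ↔ a = toSite y` (both maps are the identity of the carrier). [folklore] -/
private theorem ofSite_eq_iff {d : ℕ} {m : Fin d → ℕ} (a : TSite d m) (y : UT m) : UT.ofSite m a = y ↔ a = UT.toSite m y := by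
  constructor
  · rintro rfl; rfl
  · rintro rfl; rfl

variable {d : ℕ} {L : ℕ} {n : ℕ} {c₀ : ℝ} {W : Type} [NormedAddCommGroup W] [InnerProductSpace ℂ W]
  (m : Fin d → ℕ) [∀ i, NeZero (m i)] (η₀ L₀ M₀ R : ℝ) (H : Prop)

/-- **THE (3.137) DISPLAY PACKAGED.**  On the fine bond carrier of NE9's tower, blocks = the unit torus `UT m` through `blockCoord ∘ bpos`, geometry
`toB6 (torusGeom m …)` (distance `d₁`): from `λ₀ ≥ 0`, a rate `σ > 0`, `c = c₀(1,σ)^d` and print's (3.137) sentence for a `ℂ`-linear `Δ⁽²⁾` — `‖(Δ⁽²⁾A)(b)‖ ≤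
λ₀·F` whenever `‖A(b′)‖ ≤ F` on the fine bonds whose blocks lie within `d₁`-distance `r_D` of the block of `b` — the six data the ENDs «Y12f∕g∕h» display:
`0 ≤ λ`, `K_D ≥ 0`, `K_D(y,v) ≠ 0 → d(y,v) ≤ r_D`, row sums `≤ λ`, column sums `≤ λ`, `HasMaj S^{fine} S^{fine} (Δ⁽²⁾)ᵉ↾ℝ K_D`, for `K_D = λ₀·𝟙[d₁ ≤ r_D]` and
`λ = λ₀·e^{σ r_D}·c` (§1–§2). [cite: Balaban1985BackgroundPropagators, (3.137) p.423] [cite: Balaban1984PropagatorsII, (2.51)–(2.52) p.232, Lemma 2.1 (2.61) p.234]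
[cite: Balaban1985Variational, (190) p.308] -/
theorem localSup_package {σ c : ℝ} (hσ : 0 < σ) (hc_def : c = B6.c0 1 σ ^ d)
    (D2 : BondL2K ℂ d (towerP L m (n + 1)) c₀ W →ₗ[ℂ] BondL2K ℂ d (towerP L m (n + 1)) c₀ W)
    {lam₀ rD : ℝ} (hlam₀ : 0 ≤ lam₀)
    (hD2 : ∀ (A : Bond d (towerP L m (n + 1)) → W) (b : Bond d (towerP L m (n + 1))) (F : ℝ), 0 ≤ F →
      (∀ b' : Bond d (towerP L m (n + 1)),
        tdist1 m (UT.ofSite m (blockCoord (L ^ (n + 1)) m (siteCast (towerP_eq_fineP_pow L m (n + 1)) (bpos b))))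
          (UT.ofSite m (blockCoord (L ^ (n + 1)) m (siteCast (towerP_eq_fineP_pow L m (n + 1)) (bpos b')))) ≤ rD → ‖A b'‖ ≤ F) →
      ‖((WL2.linearEquiv ℂ ℂ (fun _ : Bond d (towerP L m (n + 1)) => c₀) :
            BondL2K ℂ d (towerP L m (n + 1)) c₀ W ≃ₗ[ℂ] (Bond d (towerP L m (n + 1)) → W)).toLinearMap ∘ₗ D2 ∘ₗ
          (WL2.linearEquiv ℂ ℂ (fun _ : Bond d (towerP L m (n + 1)) => c₀) :
            BondL2K ℂ d (towerP L m (n + 1)) c₀ W ≃ₗ[ℂ] (Bond d (towerP L m (n + 1)) → W)).symm.toLinearMap) A b‖ ≤ lam₀ * F) :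
    0 ≤ lam₀ * Real.exp (σ * rD) * c ∧
    (∀ y v : UT m, 0 ≤ (if tdist1 m y v ≤ rD then lam₀ else 0)) ∧
    (∀ y v : UT m, (if tdist1 m y v ≤ rD then lam₀ else 0) ≠ 0 → (toB6 (torusGeom m η₀ L₀ M₀) R H).dist y v ≤ rD) ∧
    (∀ y : UT m, ∑ v : UT m, (if tdist1 m y v ≤ rD then lam₀ else 0) ≤ lam₀ * Real.exp (σ * rD) * c) ∧
    (∀ v : UT m, ∑ y : UT m, (if tdist1 m y v ≤ rD then lam₀ else 0) ≤ lam₀ * Real.exp (σ * rD) * c) ∧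
    HasMaj
      (supSize (toB6 (torusGeom m η₀ L₀ M₀) R H)
        (fun y => Finset.univ.filter fun b : Bond d (towerP L m (n + 1)) =>
          blockCoord (L ^ (n + 1)) m (siteCast (towerP_eq_fineP_pow L m (n + 1)) (bpos b)) = UT.toSite m y)
        (fun b => UT.ofSite m (blockCoord (L ^ (n + 1)) m (siteCast (towerP_eq_fineP_pow L m (n + 1)) (bpos b)))) :
          BlockNorm (toB6 (torusGeom m η₀ L₀ M₀) R H) (Bond d (towerP L m (n + 1)) → W))
      (supSize (toB6 (torusGeom m η₀ L₀ M₀) R H)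
        (fun y => Finset.univ.filter fun b : Bond d (towerP L m (n + 1)) =>
          blockCoord (L ^ (n + 1)) m (siteCast (towerP_eq_fineP_pow L m (n + 1)) (bpos b)) = UT.toSite m y)
        (fun b => UT.ofSite m (blockCoord (L ^ (n + 1)) m (siteCast (towerP_eq_fineP_pow L m (n + 1)) (bpos b)))))
      (((WL2.linearEquiv ℂ ℂ (fun _ : Bond d (towerP L m (n + 1)) => c₀) :
            BondL2K ℂ d (towerP L m (n + 1)) c₀ W ≃ₗ[ℂ] (Bond d (towerP L m (n + 1)) → W)).toLinearMap ∘ₗ D2 ∘ₗ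
          (WL2.linearEquiv ℂ ℂ (fun _ : Bond d (towerP L m (n + 1)) => c₀) :
            BondL2K ℂ d (towerP L m (n + 1)) c₀ W ≃ₗ[ℂ] (Bond d (towerP L m (n + 1)) → W)).symm.toLinearMap).restrictScalars ℝ)
      (fun y v => if tdist1 m y v ≤ rD then lam₀ else 0) := by
  have hbox : ∀ (y : UT m) (b : Bond d (towerP L m (n + 1))),
      b ∈ (Finset.univ.filter fun b : Bond d (towerP L m (n + 1)) =>
          blockCoord (L ^ (n + 1)) m (siteCast (towerP_eq_fineP_pow L m (n + 1)) (bpos b)) = UT.toSite m y) ↔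
        UT.ofSite m (blockCoord (L ^ (n + 1)) m (siteCast (towerP_eq_fineP_pow L m (n + 1)) (bpos b))) = y := fun y b => by
    rw [Finset.mem_filter, ofSite_eq_iff]; simp
  have hdist : ∀ y v : UT m, (toB6 (torusGeom m η₀ L₀ M₀) R H).dist y v = tdist1 m y v := fun _ _ => rfl
  refine ⟨?_, fun y v => ?_, fun y v h => ?_, fun y => ?_, fun v => ?_, ?_⟩
  · rw [hc_def]; exact mul_nonneg (mul_nonneg hlam₀ (Real.exp_pos _).le) (pow_nonneg (B6RandomWalk.c0_nonneg 1 σ) _)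
  · split_ifs <;> [exact hlam₀; exact le_rfl]
  · rw [hdist]; by_contra hc; exact h (if_neg hc)
  · rw [hc_def]; exact sum_localSupKernel_le y hlam₀ hσ
  · rw [hc_def]; exact sum_localSupKernel_le' v hlam₀ hσ
  · exact hasMaj_supSize_of_localSup (g := toB6 (torusGeom m η₀ L₀ M₀) R H) (E := W) hbox _ (r := rD) hlam₀
      (fun A b F hF hA => hD2 A b F hF hA)

end Package

/-! ## §4  The value line of NODE D at the origin on print's class, `Δ⁽²⁾` in print's (3.137) display -/

section Tower

variable {d : ℕ} (hd : 1 ≤ d) (L : ℕ) [NeZero L] (hL : 1 ≤ L) (hL3 : 3 ≤ L)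
  {𝔸 : Type*} [CStarAlgebra 𝔸] [Nontrivial 𝔸]
  {W : Type} [NormedAddCommGroup W] [InnerProductSpace ℂ W] [FiniteDimensional ℂ W] (φ : W ≃ₗ[ℂ] 𝔸)
  {Mφ Mφ' : ℝ} (hMφ : 0 ≤ Mφ) (hMφ' : 0 ≤ Mφ') (hφ : ∀ w, ‖φ w‖ ≤ Mφ * ‖w‖) (hφ' : ∀ X, ‖φ.symm X‖ ≤ Mφ' * ‖X‖)
  {a : ℝ} (ha : 0 < a) {a' : ℝ} (ha' : 0 < a')
  (τ : 𝔸 →ₗ[ℂ] ℂ) {Cτ : ℝ} (hτ : ∀ X, ‖τ X‖ ≤ Cτ * ‖X‖) (hCτ : 0 ≤ Cτ) {Mτ : ℝ} (hτm : ∀ X Y : 𝔸, ‖τ (X * Y)‖ ≤ Mτ * ‖X‖ * ‖Y‖) (hMτ : 0 ≤ Mτ)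
  {ρw : ℝ} (hρw : 0 ≤ ρw)
  (hτ₁ : ∀ X : 𝔸, τ (star X) = conj (τ X)) (hτ₂ : ∀ X Y : 𝔸, τ (X * Y) = τ (Y * X)) (hφτ : ∀ X Y : 𝔸, ⟪φ.symm X, φ.symm Y⟫_ℂ = τ (star X * Y))
  (AQ : ℝ) (hAQ16 : 16 * ((d : ℝ) + 1) * ((d : ℝ) + 4) * c2' d L ≤ AQ)

set_option maxHeartbeats 400000 in
include hd hL hL3 hMφ hMφ' hφ hφ' ha ha' hτ hCτ hτm hMτ hρw hτ₁ hτ₂ hφτ hAQ16 in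
/-- **NODE D OF ROW (D4) AT THE ORIGIN ON PRINT's CLASS, `Δ⁽²⁾` IN PRINT's (3.137) DISPLAY** («Y12f» `exists_ineq190_origin_tower_plaquette_anyDisplay` with its
block-majorant letter `hD2` re-typed): `∃ (α⋆, B, δ, A′, r₁)` first; under the `∀` the diagonal, weights, period, a `unitaryUnits`-valued `U` in the three-window
class (`α ≤ α⋆`), the consumer's display `(αU, hα1, hαL, hU1, hreg)` and witness `hpos`, geometry, rates, a `ℂ`-linear `Δ⁽²⁾` on the fine carrier with
print's (3.137) sentence *«|(Δ⁽²⁾A)(b)| ≤ λ₀·|A|, the supremum |A| taken over the blocks surrounding Δ(y)»* (`λ₀ ≥ 0`, block range `r_D` in the `ℓ¹`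
distance of the torus of blocks), the derived constants (`rfl`; `λ = λ₀·e^{σ r_D}·c₀(1,σ)^d`) and the two smallnesses; CONCLUSION verbatim as in «Y12f»:
`G′ = (Δ_{a,k}(U) − Δ⁽²⁾)⁻¹`, `(Q_kG′Q_k†)⁻¹` CONSTRUCTED two-sided and `∀ δ′, δ′∕8 ≤ ρ → Ineq190 S^{coarse}_m S^{fine}_m (H₀ + G̃Δ⁽²⁾H₀) (A₀ + B_G̃θ_Dc) δ′`,
`H₀ = (H1k … αU … hαL hpos)ᵉ↾ℝ` the consumer's term ([15] (182): `(δ/δB)𝓗(0) = H₀ + G̃Δ⁽²⁾H₀`; (190) at the origin).  Mechanism: the indicator kernel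
`K_D = λ₀·𝟙[d₁ ≤ r_D]` (§3 `localSup_package`: §1 `hasMaj_supSize_of_localSup` + §2 row ∕ column sums) fed to «Y12f».
[cite: Balaban1985BackgroundPropagators, (3.137)–(3.138) p.423, (3.134)–(3.136) p.422, Thm 3.1 (3.42) p.397, Thm 3.3 p.399, Thm 3.11 p.416, (3.35)–(3.37) p.396, (3.126) p.420, (3.132)–(3.133) p.422]
[cite: Balaban1985Variational, (182) p.307, (190) p.308, (129)–(131) pp.297–298, (180) p.306] [cite: Balaban1985Averaging, Prop. 2 (52)–(54) p.26, (122) p.36, (136) p.39]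
[cite: Balaban1984PropagatorsII, (2.51)–(2.52) p.232, (2.54) p.233, Lemma 2.1 (2.61) p.234] -/
theorem exists_ineq190_origin_tower_plaquette_localSup :
    ∃ αs B δ A' r₁ : ℝ, 0 < αs ∧ 0 ≤ B ∧ 0 < δ ∧ 0 ≤ A' ∧ 0 < r₁ ∧
      ∀ (n : ℕ) (η : ℝ) (_hηL : η * (L : ℝ) ^ (n + 1) = 1) (c₀ c₁ : ℝ) [Fact (0 < c₀)] [Fact (0 < c₁)]
        (_hw : c₀ * ((L : ℝ) ^ (n + 1)) ^ d = c₁) (_hρ : |η| ^ d / c₀ ≤ ρw) (m : Fin d → ℕ) [∀ i, NeZero (m i)] (_hm : ∀ i, 1 ≤ m i)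
        (U : Bond d (towerP L m (n + 1)) → 𝔸ˣ) (_hUu : ∀ b, U b ∈ unitaryUnits 𝔸)
        (α : ℝ) (_hα : 0 ≤ α) (_hαle : α ≤ αs) (_hUη : ∀ b, ‖(U b : 𝔸) - 1‖ ≤ α * η)
        (_hpl : ∀ p : B9SectCLatticeCarrier.Plaq d (towerP L m (n + 1)), ‖(plaqHolU U p : 𝔸) - 1‖ ≤ α * η ^ 2)
        (_hUgrad : ∀ (x : TSite d (towerP L m (n + 1))) (μ : Fin d), ‖(U (x, μ) : 𝔸) - U (unshift μ x, μ)‖ ≤ α * η ^ 2)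
        -- the consumer's OWN regularity display, onto-threshold and positivity witness (ANY admissible ones):
        (αU : ℕ → ℝ) (hα1 : ∀ j, αU j ≤ 1 / 64) (hαL : ∀ j, 50 * (d + 1) * αU j * (L : ℝ) ^ d ≤ 1 / 2)
        (hU1 : ∀ (j : ℕ) (x : B7Prop1Explicit.Site d) (k : Fin d), perCfg (towerP L m (j + 1)) (UlevOf L m (n + 1) U j) x k ∈ U1 𝔸)
        (hreg : ∀ (j : ℕ) (y : TSite d (towerP L m j)) (k : Fin d) (ρ' : Fin d → Fin L),
          ‖((Wcx L (perCfg (towerP L m (j + 1)) (UlevOf L m (n + 1) U j)) (cornerSite L y) k (boxVec L ρ') : 𝔸ˣ) : 𝔸) - 1‖ ≤ αU j)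
        (hpos : ∀ x : BondL2K ℂ d (towerP L m (n + 1)) c₀ W, x ≠ 0 →
          0 < RCLike.re ⟪x, laplaceAk L m n φ η U hL αU hα1 hU1 hreg τ (c₀ := c₀) (c₁ := c₁) a x⟫_ℂ)
        (η₀ L₀ M₀ R : ℝ) (H : Prop)
        -- the rates and the (free) row-sum constant
        (ρ σ c : ℝ) (_hσ : 0 < σ) (_hρ0 : 0 ≤ ρ) (_hρ₁ : ρ + 5 * σ ≤ δ / d) (_hρI : ρ + 5 * σ ≤ r₁ / d) (_hc_def : c = B6.c0 1 σ ^ d)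
    -- `Δ⁽²⁾` IN PRINT's (3.137) DISPLAY: a `ℂ`-linear operator on the fine carrier whose value at a fine bond `b` is bounded by `λ₀ ×` the supremum
    -- of its argument over the fine bonds whose blocks lie within `ℓ¹`-distance `r_D` of the block of `b` («the supremum |A| is taken over several
    -- j-blocks surrounding Δ(y)»); NODE-O-class identification of Bałaban's `Δ⁽²⁾(U)` NOT done
    (D2 : BondL2K ℂ d (towerP L m (n + 1)) c₀ W →ₗ[ℂ] BondL2K ℂ d (towerP L m (n + 1)) c₀ W)
    {lam₀ rD : ℝ} (hlam₀ : 0 ≤ lam₀)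
    (hD2 : ∀ (A : Bond d (towerP L m (n + 1)) → W) (b : Bond d (towerP L m (n + 1))) (F : ℝ), 0 ≤ F →
      (∀ b' : Bond d (towerP L m (n + 1)),
        tdist1 m (UT.ofSite m (blockCoord (L ^ (n + 1)) m (siteCast (towerP_eq_fineP_pow L m (n + 1)) (bpos b))))
          (UT.ofSite m (blockCoord (L ^ (n + 1)) m (siteCast (towerP_eq_fineP_pow L m (n + 1)) (bpos b')))) ≤ rD → ‖A b'‖ ≤ F) →
      ‖((WL2.linearEquiv ℂ ℂ (fun _ : Bond d (towerP L m (n + 1)) => c₀) :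
            BondL2K ℂ d (towerP L m (n + 1)) c₀ W ≃ₗ[ℂ] (Bond d (towerP L m (n + 1)) → W)).toLinearMap ∘ₗ D2 ∘ₗ
          (WL2.linearEquiv ℂ ℂ (fun _ : Bond d (towerP L m (n + 1)) => c₀) :
            BondL2K ℂ d (towerP L m (n + 1)) c₀ W ≃ₗ[ℂ] (Bond d (towerP L m (n + 1)) → W)).symm.toLinearMap) A b‖ ≤ lam₀ * F)
    -- the derived constants, bound to their closed forms (instantiate with `rfl`; `λ = λ₀·e^{σ r_D}·c`), and the TWO smallnesses in `λ₀`
    {q BG' θP qI BI' A₀ θD BGt : ℝ}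
    (hq_def : q = B * (lam₀ * Real.exp (σ * rD) * c) * Real.exp (δ / d * rD) * c) (hq : q < 1) (hBG' : BG' = B * (1 - q)⁻¹)
    (hθP : θP = B * (lam₀ * Real.exp (σ * rD) * c) * Real.exp (δ / d * rD) * BG' * c *
      ((Mφ' * Real.exp (100 * d * (d + 1) * (L : ℝ) ^ d * AQ) * Mφ * ((2 * d : ℕ) : ℝ)) * Real.exp 1 * latticeConst d 1) *
      Real.exp ((ρ + 4 * σ) * d) * ((Mφ' * Mφ * Real.exp (50 * (d + 1) * AQ)) * Real.exp 1 * latticeConst d 1) *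
      Real.exp ((ρ + 4 * σ) * d))
    (hqI : qI = A' * θP * c * c) (hqI1 : qI < 1) (hBI' : BI' = A' * (1 - qI)⁻¹)
    (hA₀ : A₀ = B * ((Mφ' * Real.exp (100 * d * (d + 1) * (L : ℝ) ^ d * AQ) * Mφ * ((2 * d : ℕ) : ℝ)) * Real.exp 1 *
      latticeConst d 1) * Real.exp δ * A' * c)
    (hθD : θD = A₀ * (lam₀ * Real.exp (σ * rD) * c) * Real.exp (ρ * rD))
    (hBGt : BGt = BG' + ((Mφ' * Mφ * Real.exp (50 * (d + 1) * AQ)) * Real.exp 1 * latticeConst d 1) *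
      ((Mφ' * Real.exp (100 * d * (d + 1) * (L : ℝ) ^ d * AQ) * Mφ * ((2 * d : ℕ) : ℝ)) * Real.exp 1 * latticeConst d 1) *
      BI' * BG' * BG' * Real.exp ((ρ + 2 * σ) * d) * Real.exp ((ρ + 2 * σ) * d) * c * c),
    ∃ (G' : (Bond d (towerP L m (n + 1)) → W) →L[ℂ] (Bond d (towerP L m (n + 1)) → W))
      (Inv' : (Bond d m → W) →L[ℂ] (Bond d m → W)),
      -- `G′ = (Δ_{a,k}(U) − Δ⁽²⁾)⁻¹`, two-sided
      G' * (LinearMap.toContinuousLinearMap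
          ((WL2.linearEquiv ℂ ℂ (fun _ : Bond d (towerP L m (n + 1)) => c₀) :
              BondL2K ℂ d (towerP L m (n + 1)) c₀ W ≃ₗ[ℂ] (Bond d (towerP L m (n + 1)) → W)).toLinearMap ∘ₗ
            laplaceAk L m n φ η U hL αU hα1 hU1 hreg τ (c₀ := c₀) (c₁ := c₁) a ∘ₗ
            (WL2.linearEquiv ℂ ℂ (fun _ : Bond d (towerP L m (n + 1)) => c₀) :
              BondL2K ℂ d (towerP L m (n + 1)) c₀ W ≃ₗ[ℂ] (Bond d (towerP L m (n + 1)) → W)).symm.toLinearMap) -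
        LinearMap.toContinuousLinearMap
          ((WL2.linearEquiv ℂ ℂ (fun _ : Bond d (towerP L m (n + 1)) => c₀) :
              BondL2K ℂ d (towerP L m (n + 1)) c₀ W ≃ₗ[ℂ] (Bond d (towerP L m (n + 1)) → W)).toLinearMap ∘ₗ D2 ∘ₗ
            (WL2.linearEquiv ℂ ℂ (fun _ : Bond d (towerP L m (n + 1)) => c₀) :
              BondL2K ℂ d (towerP L m (n + 1)) c₀ W ≃ₗ[ℂ] (Bond d (towerP L m (n + 1)) → W)).symm.toLinearMap)) = 1 ∧
      (LinearMap.toContinuousLinearMap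
          ((WL2.linearEquiv ℂ ℂ (fun _ : Bond d (towerP L m (n + 1)) => c₀) :
              BondL2K ℂ d (towerP L m (n + 1)) c₀ W ≃ₗ[ℂ] (Bond d (towerP L m (n + 1)) → W)).toLinearMap ∘ₗ
            laplaceAk L m n φ η U hL αU hα1 hU1 hreg τ (c₀ := c₀) (c₁ := c₁) a ∘ₗ
            (WL2.linearEquiv ℂ ℂ (fun _ : Bond d (towerP L m (n + 1)) => c₀) :
              BondL2K ℂ d (towerP L m (n + 1)) c₀ W ≃ₗ[ℂ] (Bond d (towerP L m (n + 1)) → W)).symm.toLinearMap) -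
        LinearMap.toContinuousLinearMap
          ((WL2.linearEquiv ℂ ℂ (fun _ : Bond d (towerP L m (n + 1)) => c₀) :
              BondL2K ℂ d (towerP L m (n + 1)) c₀ W ≃ₗ[ℂ] (Bond d (towerP L m (n + 1)) → W)).toLinearMap ∘ₗ D2 ∘ₗ
            (WL2.linearEquiv ℂ ℂ (fun _ : Bond d (towerP L m (n + 1)) => c₀) :
              BondL2K ℂ d (towerP L m (n + 1)) c₀ W ≃ₗ[ℂ] (Bond d (towerP L m (n + 1)) → W)).symm.toLinearMap)) * G' = 1 ∧
      -- `Inv′ = (Q_kG′Q_k†)⁻¹`, two-sided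
      Inv' * ((LinearMap.toContinuousLinearMap
          ((WL2.linearEquiv ℂ ℂ (fun _ : Bond d m => c₁) : BondL2K ℂ d m c₁ W ≃ₗ[ℂ] (Bond d m → W)).toLinearMap ∘ₗ
            QkW L m n φ U hL αU hα1 hU1 hreg (c₀ := c₀) (c₁ := c₁) ∘ₗ
            (WL2.linearEquiv ℂ ℂ (fun _ : Bond d (towerP L m (n + 1)) => c₀) :
              BondL2K ℂ d (towerP L m (n + 1)) c₀ W ≃ₗ[ℂ] (Bond d (towerP L m (n + 1)) → W)).symm.toLinearMap)).comp
        (G'.comp (LinearMap.toContinuousLinearMap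
          ((WL2.linearEquiv ℂ ℂ (fun _ : Bond d (towerP L m (n + 1)) => c₀) :
              BondL2K ℂ d (towerP L m (n + 1)) c₀ W ≃ₗ[ℂ] (Bond d (towerP L m (n + 1)) → W)).toLinearMap ∘ₗ
            LinearMap.adjoint (QkW L m n φ U hL αU hα1 hU1 hreg (c₀ := c₀) (c₁ := c₁)) ∘ₗ
            (WL2.linearEquiv ℂ ℂ (fun _ : Bond d m => c₁) : BondL2K ℂ d m c₁ W ≃ₗ[ℂ] (Bond d m → W)).symm.toLinearMap)))) = 1 ∧
      ((LinearMap.toContinuousLinearMap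
          ((WL2.linearEquiv ℂ ℂ (fun _ : Bond d m => c₁) : BondL2K ℂ d m c₁ W ≃ₗ[ℂ] (Bond d m → W)).toLinearMap ∘ₗ
            QkW L m n φ U hL αU hα1 hU1 hreg (c₀ := c₀) (c₁ := c₁) ∘ₗ
            (WL2.linearEquiv ℂ ℂ (fun _ : Bond d (towerP L m (n + 1)) => c₀) :
              BondL2K ℂ d (towerP L m (n + 1)) c₀ W ≃ₗ[ℂ] (Bond d (towerP L m (n + 1)) → W)).symm.toLinearMap)).comp
        (G'.comp (LinearMap.toContinuousLinearMap
          ((WL2.linearEquiv ℂ ℂ (fun _ : Bond d (towerP L m (n + 1)) => c₀) :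
              BondL2K ℂ d (towerP L m (n + 1)) c₀ W ≃ₗ[ℂ] (Bond d (towerP L m (n + 1)) → W)).toLinearMap ∘ₗ
            LinearMap.adjoint (QkW L m n φ U hL αU hα1 hU1 hreg (c₀ := c₀) (c₁ := c₁)) ∘ₗ
            (WL2.linearEquiv ℂ ℂ (fun _ : Bond d m => c₁) : BondL2K ℂ d m c₁ W ≃ₗ[ℂ] (Bond d m → W)).symm.toLinearMap)))) * Inv' = 1 ∧
      -- the (190) letter of `H₀ + G̃Δ⁽²⁾H₀`, `H₀ = H₁,k(U)` by name, `G̃ = G′ − G′Q_k†·Inv′·Q_kG′`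
      ∀ δ' : ℝ, δ' / 8 ≤ ρ →
        Ineq190
          (supSize (toB6 (torusGeom m η₀ L₀ M₀) R H)
            (fun y => Finset.univ.filter fun c : Bond d m => bpos c = UT.toSite m y)
            (fun c => UT.ofSite m (bpos c)) : BlockNorm (toB6 (torusGeom m η₀ L₀ M₀) R H) (Bond d m → W))
          (supSize (toB6 (torusGeom m η₀ L₀ M₀) R H)
            (fun y => Finset.univ.filter fun b : Bond d (towerP L m (n + 1)) =>
              blockCoord (L ^ (n + 1)) m (siteCast (towerP_eq_fineP_pow L m (n + 1)) (bpos b)) = UT.toSite m y)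
            (fun b => UT.ofSite m (blockCoord (L ^ (n + 1)) m (siteCast (towerP_eq_fineP_pow L m (n + 1)) (bpos b)))) :
              BlockNorm (toB6 (torusGeom m η₀ L₀ M₀) R H) (Bond d (towerP L m (n + 1)) → W))
          ((((WL2.linearEquiv ℂ ℂ (fun _ : Bond d (towerP L m (n + 1)) => c₀) :
                  BondL2K ℂ d (towerP L m (n + 1)) c₀ W ≃ₗ[ℂ] (Bond d (towerP L m (n + 1)) → W)).toLinearMap ∘ₗ
              H1k L m n φ η U hL αU hα1 hU1 hreg τ (c₀ := c₀) (c₁ := c₁) hαL hpos ∘ₗ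
              (WL2.linearEquiv ℂ ℂ (fun _ : Bond d m => c₁) : BondL2K ℂ d m c₁ W ≃ₗ[ℂ] (Bond d m → W)).symm.toLinearMap).restrictScalars ℝ) +
            ((G'.restrictScalars ℝ : (Bond d (towerP L m (n + 1)) → W) →ₗ[ℝ] (Bond d (towerP L m (n + 1)) → W)) -
              ((G'.restrictScalars ℝ : (Bond d (towerP L m (n + 1)) → W) →ₗ[ℝ] (Bond d (towerP L m (n + 1)) → W)) ∘ₗ
                (((WL2.linearEquiv ℂ ℂ (fun _ : Bond d (towerP L m (n + 1)) => c₀) :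
                      BondL2K ℂ d (towerP L m (n + 1)) c₀ W ≃ₗ[ℂ] (Bond d (towerP L m (n + 1)) → W)).toLinearMap ∘ₗ
                  LinearMap.adjoint (QkW L m n φ U hL αU hα1 hU1 hreg (c₀ := c₀) (c₁ := c₁)) ∘ₗ
                  (WL2.linearEquiv ℂ ℂ (fun _ : Bond d m => c₁) : BondL2K ℂ d m c₁ W ≃ₗ[ℂ] (Bond d m → W)).symm.toLinearMap).restrictScalars ℝ)) ∘ₗ
              (Inv'.restrictScalars ℝ : (Bond d m → W) →ₗ[ℝ] (Bond d m → W)) ∘ₗ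
              ((((WL2.linearEquiv ℂ ℂ (fun _ : Bond d m => c₁) : BondL2K ℂ d m c₁ W ≃ₗ[ℂ] (Bond d m → W)).toLinearMap ∘ₗ
                  QkW L m n φ U hL αU hα1 hU1 hreg (c₀ := c₀) (c₁ := c₁) ∘ₗ
                  (WL2.linearEquiv ℂ ℂ (fun _ : Bond d (towerP L m (n + 1)) => c₀) :
                    BondL2K ℂ d (towerP L m (n + 1)) c₀ W ≃ₗ[ℂ] (Bond d (towerP L m (n + 1)) → W)).symm.toLinearMap).restrictScalars ℝ) ∘ₗ
                (G'.restrictScalars ℝ : (Bond d (towerP L m (n + 1)) → W) →ₗ[ℝ] (Bond d (towerP L m (n + 1)) → W)))) ∘ₗ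
            ((((WL2.linearEquiv ℂ ℂ (fun _ : Bond d (towerP L m (n + 1)) => c₀) :
                    BondL2K ℂ d (towerP L m (n + 1)) c₀ W ≃ₗ[ℂ] (Bond d (towerP L m (n + 1)) → W)).toLinearMap ∘ₗ D2 ∘ₗ
                (WL2.linearEquiv ℂ ℂ (fun _ : Bond d (towerP L m (n + 1)) => c₀) :
                  BondL2K ℂ d (towerP L m (n + 1)) c₀ W ≃ₗ[ℂ] (Bond d (towerP L m (n + 1)) → W)).symm.toLinearMap).restrictScalars ℝ) ∘ₗ
              (((WL2.linearEquiv ℂ ℂ (fun _ : Bond d (towerP L m (n + 1)) => c₀) :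
                    BondL2K ℂ d (towerP L m (n + 1)) c₀ W ≃ₗ[ℂ] (Bond d (towerP L m (n + 1)) → W)).toLinearMap ∘ₗ
                H1k L m n φ η U hL αU hα1 hU1 hreg τ (c₀ := c₀) (c₁ := c₁) hαL hpos ∘ₗ
                (WL2.linearEquiv ℂ ℂ (fun _ : Bond d m => c₁) : BondL2K ℂ d m c₁ W ≃ₗ[ℂ] (Bond d m → W)).symm.toLinearMap).restrictScalars ℝ)))
          (A₀ + BGt * θD * c) δ' := by
  obtain ⟨αs, B, δ, A', r₁, hαs, hB, hδ, hA', hr₁, HY⟩ :=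
    exists_ineq190_origin_tower_plaquette_anyDisplay hd L hL hL3 φ hMφ hMφ' hφ hφ' ha ha' τ hτ hCτ hτm hMτ hρw hτ₁ hτ₂ hφτ AQ hAQ16
  refine ⟨αs, B, δ, A', r₁, hαs, hB, hδ, hA', hr₁, ?_⟩
  intro n η hηL c₀ c₁ _ _ hw hρ m _ hm U hUu α hα hαle hUη hpl hUgrad αU hα1 hαL hU1 hreg hpos η₀ L₀ M₀ R H ρ σ c hσ hρ0 hρ₁ hρI hc_def D2 lam₀ rD
    hlam₀ hD2 q BG' θP qI BI' A₀ θD BGt hq_def hq hBG' hθP hqI hqI1 hBI' hA₀ hθD hBGt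
  -- print's (3.137) display IS the block majorant `K_D = λ₀·𝟙[d₁ ≤ r_D]` with its range and row ∕ column sums (§3)
  obtain ⟨hlam, hKD, hDloc, hDrow, hDcol, hD2'⟩ :=
    localSup_package (L := L) (n := n) (c₀ := c₀) (W := W) m η₀ L₀ M₀ R H hσ hc_def D2 hlam₀ hD2
  exact HY n η hηL c₀ c₁ hw hρ m hm U hUu α hα hαle hUη hpl hUgrad αU hα1 hαL hU1 hreg hpos η₀ L₀ M₀ R H ρ σ c hσ hρ0 hρ₁ hρI hc_def D2
    hlam hKD hDloc hDrow hDcol hD2' hq_def hq hBG' hθP hqI hqI1 hBI' hA₀ hθD hBGt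

end Tower

end Literature.MathematicalPhysics.QuantumFieldTheory.Balaban1983to89.Beta.RemainderOriginTowerPlaquetteLocalSup

end
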